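import Mathlib
import Literature.Analysis.FluidPDE.IsometryInvariance
import Summits.NavierStokesRegularity.NavierStokesRegularity.Theorems.PlaneEnergyCeilingPlanarEnergyAPrioriOfBudget
import Summits.NavierStokesRegularity.NavierStokesRegularity.Theorems.PlaneEnergyCeilingPlanarEnergyAPrioriBudgetCalculus

/-!
# Route PlaneEnergyCeiling · crux `PlanarEnergyAPriori` ⇐ the LATE flux-convergence budget

Helper file for the crux item stmt-NavierStokesRegularity-16855 (`PlanarEnergyAPriori`, route
`PlaneEnergyCeiling`), landed `--supports` that item. It sharpens the landed reduction
`planarEnergyAPriori_of_fluxConvergenceBudget` (stub 4 → crux): the parabolic flux-convergence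
budget is needed ONLY ON A FINAL STRETCH `[T₁,T)`. Precisely (`planarEnergyAPriori_of_lateBudget`):
if along every classical Leray–Hopf solution from a rapidly decaying datum on `[0,T)` there are
`T₁ ∈ [0,T)` and `B` with

  `∫_{(T₁,t)} (√(πν(t−s)))⁻¹ · osc_{a,b} ‖F(s;R,a) − F(s;R,b)‖ₑ ds ≤ B`  for all `t ∈ [T₁,T)`, all `R`,

then `PlaneEnergyCeiling.PlanarEnergyAPriori` holds. The early part of the budget is discharged
here by the persisted decay (landed `stub_decayPersistence`): on `[0,T₁]` the Bernoulli flux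
through every plane is bounded (`enorm_bernoulliFlux_sub_le_of_decay`, the pressure constant
dropping out by `planarFlux`), and a bounded oscillation costs at most `2(√(πν))⁻¹ A √T`
(landed `fluxBudget_le_of_oscRate`). So the whole content of the crux is the behaviour of the flux
oscillation as `s ↑ T`. Folklore bookkeeping over the landed stubs.
-/

noncomputable section

-- single-conjunct summit: `Summit.<Summit>.<Problem>` repeats the name by the D-0017 layout
set_option linter.dupNamespace false

namespace Summit.NavierStokesRegularity.NavierStokesRegularity.Theorems.PlanarEnergyAPriori

open MeasureTheory Set Filter Topology Function WithLp Real
open scoped ENNReal RealInnerProductSpace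
open Literature.Analysis.FluidPDE
open Summit.NavierStokesRegularity.NavierStokesRegularity.Theorems.PlaneEnergyCeilingSlabEnergyIdentity
open Summit.NavierStokesRegularity.NavierStokesRegularity.Theorems.PlanarEnergyAPriori.SlabLaw

/-! ### The Bernoulli flux under decay -/

/-- The Bernoulli flux of `u` through the plane `R{x₂ = a}` is the coordinate flux of the conjugate
pair `(R⁻¹ ∘ u ∘ R, p ∘ R)`. -/
theorem bernoulliFlux_dir_eq_conj (u : EuclideanSpace ℝ (Fin 3) → EuclideanSpace ℝ (Fin 3)) (p : EuclideanSpace ℝ (Fin 3) → ℝ)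
    (R : EuclideanSpace ℝ (Fin 3) ≃ₗᵢ[ℝ] EuclideanSpace ℝ (Fin 3)) (a : ℝ) :
    ∫ y : EuclideanSpace ℝ (Fin 2), (‖u (R (toLp 2 ![y 0, y 1, a]))‖ ^ 2 / 2 + p (R (toLp 2 ![y 0, y 1, a]))) *
        ⟪u (R (toLp 2 ![y 0, y 1, a])), R (EuclideanSpace.single 2 1)⟫ =
      ∫ y : EuclideanSpace ℝ (Fin 2), (‖R.symm (u (R (toLp 2 ![y 0, y 1, a])))‖ ^ 2 / 2 + p (R (toLp 2 ![y 0, y 1, a]))) *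
        (R.symm (u (R (toLp 2 ![y 0, y 1, a])))) 2 := by
  refine integral_congr_ae (ae_of_all _ fun y => ?_)
  dsimp only
  rw [LinearIsometryEquiv.norm_map]
  congr 1
  have : (R.symm (u (R (toLp 2 ![y 0, y 1, a])))) 2 =
      ⟪R.symm (u (R (toLp 2 ![y 0, y 1, a]))), EuclideanSpace.single 2 1⟫ := by
    simp [EuclideanSpace.inner_single_right]
  rw [this]
  conv_rhs => rw [← LinearIsometryEquiv.inner_map_map R, LinearIsometryEquiv.apply_symm_apply]

/-- The coordinate Bernoulli flux is bounded under order-(3,2) decay: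
`|∫_{x₂=a}(|v|²/2 + q)v₂| ≤ (C³/2 + C²) ∫_{ℝ²}(1+‖y‖)⁻⁵`. -/
theorem abs_bernoulliFlux_coord_le {v : EuclideanSpace ℝ (Fin 3) → EuclideanSpace ℝ (Fin 3)} {q : EuclideanSpace ℝ (Fin 3) → ℝ}
    {C : ℝ} (hC : 0 ≤ C) (h0 : ∀ x, ‖v x‖ ≤ C * (1 + ‖x‖) ^ (-(3 : ℝ)))
    (k0 : ∀ x, ‖q x‖ ≤ C * (1 + ‖x‖) ^ (-(2 : ℝ))) (a : ℝ) :
    |∫ y : EuclideanSpace ℝ (Fin 2), (‖v (toLp 2 ![y 0, y 1, a])‖ ^ 2 / 2 + q (toLp 2 ![y 0, y 1, a])) * v (toLp 2 ![y 0, y 1, a]) 2| ≤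
      (C ^ 3 / 2 + C ^ 2) * ∫ y : EuclideanSpace ℝ (Fin 2), (1 + ‖y‖) ^ (-(5 : ℝ)) := by
  have hr5 : (Module.finrank ℝ (EuclideanSpace ℝ (Fin 2)) : ℝ) < 5 := by
    rw [finrank_euclideanSpace, Fintype.card_fin]; norm_num
  rw [← Real.norm_eq_abs, ← integral_const_mul]
  refine norm_integral_le_of_norm_le ((integrable_one_add_norm hr5).const_mul _) (ae_of_all _ fun y => ?_)
  exact (norm_bernoulli_mul_le_weight hC (h0 _) (k0 _) 2).trans
    (mul_le_mul_of_nonneg_left (rpow_neg_toLp_vec3_le y a (by norm_num)) (by positivity))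

/-- **The Bernoulli flux oscillation is bounded under decay, in every direction.** For a `C¹`
divergence-free `u` and a continuous `p` with `‖u‖, ‖Du‖ ≤ C(1+‖x‖)⁻³`, `|p − π| ≤ C(1+‖x‖)⁻²`:
`‖F(R,a) − F(R,b)‖ₑ ≤ ofReal (2(C³/2 + C²)∫_{ℝ²}(1+‖y‖)⁻⁵)` for every linear isometry `R` and all
offsets (the constant `π` drops out of `F` by `planarFlux`). [folklore] -/
theorem enorm_bernoulliFlux_sub_le_of_decay {u : EuclideanSpace ℝ (Fin 3) → EuclideanSpace ℝ (Fin 3)} {p : EuclideanSpace ℝ (Fin 3) → ℝ}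
    {C : ℝ} (hu : ContDiff ℝ 1 u) (hp : Continuous p) (hdiv : VectorCalculus.IsDivFree u)
    (h0 : ∀ x, ‖u x‖ ≤ C * (1 + ‖x‖) ^ (-(3 : ℝ))) (h1 : ∀ x, ‖fderiv ℝ u x‖ ≤ C * (1 + ‖x‖) ^ (-(3 : ℝ)))
    (ϖ : ℝ) (k0 : ∀ x, |p x - ϖ| ≤ C * (1 + ‖x‖) ^ (-(2 : ℝ)))
    (R : EuclideanSpace ℝ (Fin 3) ≃ₗᵢ[ℝ] EuclideanSpace ℝ (Fin 3)) (a b : ℝ) :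
    ‖(∫ y : EuclideanSpace ℝ (Fin 2), (‖u (R (toLp 2 ![y 0, y 1, a]))‖ ^ 2 / 2 + p (R (toLp 2 ![y 0, y 1, a]))) *
          ⟪u (R (toLp 2 ![y 0, y 1, a])), R (EuclideanSpace.single 2 1)⟫) -
        ∫ y : EuclideanSpace ℝ (Fin 2), (‖u (R (toLp 2 ![y 0, y 1, b]))‖ ^ 2 / 2 + p (R (toLp 2 ![y 0, y 1, b]))) *
          ⟪u (R (toLp 2 ![y 0, y 1, b])), R (EuclideanSpace.single 2 1)⟫‖ₑ ≤
      ENNReal.ofReal (2 * ((C ^ 3 / 2 + C ^ 2) * ∫ y : EuclideanSpace ℝ (Fin 2), (1 + ‖y‖) ^ (-(5 : ℝ)))) := by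
  have hC : 0 ≤ C := nonneg_of_norm_le_rpow h0
  -- the conjugate pair `v = R⁻¹ ∘ u ∘ R`, `q = p ∘ R`
  set v : EuclideanSpace ℝ (Fin 3) → EuclideanSpace ℝ (Fin 3) := fun x => R.symm (u (R.symm.symm x)) with hv
  set q : EuclideanSpace ℝ (Fin 3) → ℝ := fun x => p (R.symm.symm x) with hq
  have hvu : ∀ x, v x = R.symm (u (R x)) := fun x => by simp [hv]
  have hqp : ∀ x, q x = p (R x) := fun x => by simp [hq]
  have hv1 : ContDiff ℝ 1 v := by
    rw [hv]; exact R.symm.contDiff.comp (hu.comp R.symm.symm.contDiff)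
  have hqc : Continuous q := by rw [hq]; exact hp.comp R.symm.symm.continuous
  have hvdiv : VectorCalculus.IsDivFree v := hdiv.conj_linearIsometryEquiv (R := R.symm)
  have hv0 : ∀ x, ‖v x‖ ≤ C * (1 + ‖x‖) ^ (-(3 : ℝ)) := fun x => by
    rw [hvu, LinearIsometryEquiv.norm_map]; simpa [LinearIsometryEquiv.norm_map] using h0 (R x)
  have hvD : ∀ x, ‖fderiv ℝ v x‖ ≤ C * (1 + ‖x‖) ^ (-(3 : ℝ)) := fun x => by
    rw [hv, fderiv_conj_linearIsometryEquiv, ContinuousLinearMap.opNorm_linearIsometryEquiv_comp,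
      ContinuousLinearMap.opNorm_comp_linearIsometryEquiv]
    simpa [LinearIsometryEquiv.norm_map] using h1 (R x)
  have hq0 : ∀ x, ‖q x - ϖ‖ ≤ C * (1 + ‖x‖) ^ (-(2 : ℝ)) := fun x => by
    rw [hqp, Real.norm_eq_abs]; simpa [LinearIsometryEquiv.norm_map] using k0 (R x)
  -- the flux of `u` through `R{x₂ = ·}` is the normalised coordinate flux of `(v, q − π)`
  have hF : ∀ c, ∫ y : EuclideanSpace ℝ (Fin 2), (‖u (R (toLp 2 ![y 0, y 1, c]))‖ ^ 2 / 2 + p (R (toLp 2 ![y 0, y 1, c]))) *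
      ⟪u (R (toLp 2 ![y 0, y 1, c])), R (EuclideanSpace.single 2 1)⟫ =
      ∫ y : EuclideanSpace ℝ (Fin 2), (‖v (toLp 2 ![y 0, y 1, c])‖ ^ 2 / 2 + (q (toLp 2 ![y 0, y 1, c]) - ϖ)) *
        v (toLp 2 ![y 0, y 1, c]) 2 := fun c => by
    rw [planarBernoulliFlux_sub_const hv1 hqc hvdiv hv0 hvD ϖ hq0 c, bernoulliFlux_dir_eq_conj]
    simp only [hvu, hqp]
  rw [hF a, hF b]
  -- both normalised fluxes are bounded by `(C³/2 + C²) ∫ (1+‖y‖)⁻⁵`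
  have hbd := fun c => abs_bernoulliFlux_coord_le (q := fun x => q x - ϖ) hC hv0 hq0 c
  rw [Real.enorm_eq_ofReal_abs]
  refine ENNReal.ofReal_le_ofReal ((abs_sub _ _).trans ?_)
  have := hbd a; have := hbd b
  linarith

/-! ### The crux from a late budget -/

variable {ν T : ℝ} {u : ℝ → EuclideanSpace ℝ (Fin 3) → EuclideanSpace ℝ (Fin 3)} {p : ℝ → EuclideanSpace ℝ (Fin 3) → ℝ}

/-- **Per-solution planar ceiling from a (full) budget**: along one classical Leray–Hopf solution
from a rapidly decaying datum on `[0,T)`, a budget `≤ B` for all `t < T` and all `R` gives the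
planar ceiling `M₀ + 2B` (stubs 1–3 of the line `birth`, landed). [folklore] -/
theorem planarCeiling_of_budget (hν : 0 < ν) (hT : 0 < T) (hcl : IsClassicalNSSolutionOn (Ico 0 T) ν 0 u p)
    (hLH : IsLerayHopfOn T ν 0 (u 0) u) (hdec : HasRapidSpatialDecay (u 0)) {B : ℝ} (hB : 0 ≤ B)
    (hbud : ∀ t ∈ Ico 0 T, ∀ (R : EuclideanSpace ℝ (Fin 3) ≃ₗᵢ[ℝ] EuclideanSpace ℝ (Fin 3)),
      ∫⁻ s in Ioo 0 t, ENNReal.ofReal ((Real.sqrt (π * ν * (t - s)))⁻¹) *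
        (⨆ (a : ℝ) (b : ℝ), ‖(∫ y : EuclideanSpace ℝ (Fin 2), (‖u s (R (toLp 2 ![y 0, y 1, a]))‖ ^ 2 / 2 +
              p s (R (toLp 2 ![y 0, y 1, a]))) * ⟪u s (R (toLp 2 ![y 0, y 1, a])), R (EuclideanSpace.single 2 1)⟫) -
            ∫ y : EuclideanSpace ℝ (Fin 2), (‖u s (R (toLp 2 ![y 0, y 1, b]))‖ ^ 2 / 2 +
              p s (R (toLp 2 ![y 0, y 1, b]))) * ⟪u s (R (toLp 2 ![y 0, y 1, b])), R (EuclideanSpace.single 2 1)⟫‖ₑ) ≤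
        ENNReal.ofReal B) :
    ∃ M : ℝ, ∀ t ∈ Ico 0 T, ∀ (R : EuclideanSpace ℝ (Fin 3) ≃ₗᵢ[ℝ] EuclideanSpace ℝ (Fin 3)) (c : ℝ),
      ∫⁻ y : EuclideanSpace ℝ (Fin 2), ‖u t (R (toLp 2 ![y 0, y 1, c]))‖ₑ ^ 2 ≤ ENNReal.ofReal M := by
  obtain ⟨M₀, hM₀, hinit⟩ := stub_initialPlanarCeiling (u 0) hdec
  refine ⟨M₀ + 2 * B, fun t ht R c => ?_⟩
  have hsum : ENNReal.ofReal (M₀ + 2 * B) = ENNReal.ofReal M₀ + 2 * ENNReal.ofReal B := by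
    rw [ENNReal.ofReal_add hM₀ (by positivity), ENNReal.ofReal_mul (by norm_num : (0 : ℝ) ≤ 2), ENNReal.ofReal_ofNat]
  rcases eq_or_lt_of_le ht.1 with h0 | htpos
  · subst h0
    exact (hinit R c).trans (ENNReal.ofReal_le_ofReal (by linarith))
  · have hcl' : IsClassicalNSSolutionOn (Icc 0 t) ν 0 u p :=
      hcl.mono (Icc_subset_Ico_right ht.2) (uniqueDiffOn_Icc htpos)
    have hdecay := stub_decayPersistence ν T hν hT u p hcl hLH hdec t ht
    refine (stub_slabLawMild ν t hν htpos u p hcl' hdecay R c).trans ?_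
    rw [hsum]
    gcongr
    · exact iSup_le fun c' => hinit R c'
    · exact hbud t ht R

/-- **Per-solution planar ceiling from a LATE budget.** Along one classical Leray–Hopf solution
from a rapidly decaying datum on `[0,T)`: a budget over `(T₁,t)` bounded for `t ∈ [T₁,T)`
(`T₁ ∈ [0,T)`) already gives the planar ceiling on `[0,T)` — the budget over `(0, min(t,T₁)]` is
bounded by the persisted decay on `[0,T₁]`. [folklore] -/
theorem planarCeiling_of_lateBudget (hν : 0 < ν) (hT : 0 < T) (hcl : IsClassicalNSSolutionOn (Ico 0 T) ν 0 u p)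
    (hLH : IsLerayHopfOn T ν 0 (u 0) u) (hdec : HasRapidSpatialDecay (u 0)) {T₁ : ℝ} (hT₁ : T₁ ∈ Ico 0 T) {B : ℝ}
    (hlate : ∀ t ∈ Ico T₁ T, ∀ (R : EuclideanSpace ℝ (Fin 3) ≃ₗᵢ[ℝ] EuclideanSpace ℝ (Fin 3)),
      ∫⁻ s in Ioo T₁ t, ENNReal.ofReal ((Real.sqrt (π * ν * (t - s)))⁻¹) *
        (⨆ (a : ℝ) (b : ℝ), ‖(∫ y : EuclideanSpace ℝ (Fin 2), (‖u s (R (toLp 2 ![y 0, y 1, a]))‖ ^ 2 / 2 +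
              p s (R (toLp 2 ![y 0, y 1, a]))) * ⟪u s (R (toLp 2 ![y 0, y 1, a])), R (EuclideanSpace.single 2 1)⟫) -
            ∫ y : EuclideanSpace ℝ (Fin 2), (‖u s (R (toLp 2 ![y 0, y 1, b]))‖ ^ 2 / 2 +
              p s (R (toLp 2 ![y 0, y 1, b]))) * ⟪u s (R (toLp 2 ![y 0, y 1, b])), R (EuclideanSpace.single 2 1)⟫‖ₑ) ≤
        ENNReal.ofReal B) :
    ∃ M : ℝ, ∀ t ∈ Ico 0 T, ∀ (R : EuclideanSpace ℝ (Fin 3) ≃ₗᵢ[ℝ] EuclideanSpace ℝ (Fin 3)) (c : ℝ),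
      ∫⁻ y : EuclideanSpace ℝ (Fin 2), ‖u t (R (toLp 2 ![y 0, y 1, c]))‖ₑ ^ 2 ≤ ENNReal.ofReal M := by
  -- decay on `[0,T₁]` (landed stub 2) and the flux-oscillation bound `A` there
  obtain ⟨C₀, π₀, hd⟩ := stub_decayPersistence ν T hν hT u p hcl hLH hdec T₁ hT₁
  set A : ℝ := 2 * ((C₀ ^ 3 / 2 + C₀ ^ 2) * ∫ y : EuclideanSpace ℝ (Fin 2), (1 + ‖y‖) ^ (-(5 : ℝ))) with hA
  have hosc : ∀ s ∈ Icc 0 T₁, ∀ (R : EuclideanSpace ℝ (Fin 3) ≃ₗᵢ[ℝ] EuclideanSpace ℝ (Fin 3)),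
      (⨆ (a : ℝ) (b : ℝ), ‖(∫ y : EuclideanSpace ℝ (Fin 2), (‖u s (R (toLp 2 ![y 0, y 1, a]))‖ ^ 2 / 2 +
            p s (R (toLp 2 ![y 0, y 1, a]))) * ⟪u s (R (toLp 2 ![y 0, y 1, a])), R (EuclideanSpace.single 2 1)⟫) -
          ∫ y : EuclideanSpace ℝ (Fin 2), (‖u s (R (toLp 2 ![y 0, y 1, b]))‖ ^ 2 / 2 +
            p s (R (toLp 2 ![y 0, y 1, b]))) * ⟪u s (R (toLp 2 ![y 0, y 1, b])), R (EuclideanSpace.single 2 1)⟫‖ₑ) ≤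
        ENNReal.ofReal A := by
    intro s hs R
    have hsT : s ∈ Ico 0 T := ⟨hs.1, hs.2.trans_lt hT₁.2⟩
    have hu1 : ContDiff ℝ 1 (u s) := (hcl.contDiff_velocity hsT).of_le (by exact_mod_cast le_top)
    refine iSup₂_le fun a b => ?_
    exact enorm_bernoulliFlux_sub_le_of_decay hu1 (hcl.contDiff_pressure hsT).continuous (hcl.divFree s hsT)
      (fun x => le_mul_rpow_neg_three_of_mul_le (hd s hs x).1)
      (fun x => le_mul_rpow_neg_three_of_mul_le (hd s hs x).2.1) (π₀ s)
      (fun x => le_mul_rpow_neg_two_of_mul_le (hd s hs x).2.2.2.1) R a b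
  have hC₀ : 0 ≤ C₀ := by
    have h := (hd 0 ⟨le_rfl, hT₁.1⟩ 0).1
    have : 0 ≤ (1 + ‖(0 : EuclideanSpace ℝ (Fin 3))‖) ^ 3 * ‖u 0 0‖ := by positivity
    linarith
  have hI5 : 0 ≤ ∫ y : EuclideanSpace ℝ (Fin 2), (1 + ‖y‖) ^ (-(5 : ℝ)) :=
    integral_nonneg fun y => (Real.rpow_pos_of_pos (by positivity) _).le
  have hA0 : 0 ≤ A := by rw [hA]; positivity
  -- the early budget: a bounded oscillation costs at most `2(√(πν))⁻¹ A √T`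
  set E₁ : ℝ := 2 * (Real.sqrt (π * ν))⁻¹ * A * Real.sqrt T with hE₁
  have hE₁0 : 0 ≤ E₁ := by positivity
  have hearly : ∀ t ∈ Ico 0 T, ∀ (R : EuclideanSpace ℝ (Fin 3) ≃ₗᵢ[ℝ] EuclideanSpace ℝ (Fin 3)),
      ∫⁻ s in Ioo 0 (min t T₁), ENNReal.ofReal ((Real.sqrt (π * ν * (t - s)))⁻¹) *
        (⨆ (a : ℝ) (b : ℝ), ‖(∫ y : EuclideanSpace ℝ (Fin 2), (‖u s (R (toLp 2 ![y 0, y 1, a]))‖ ^ 2 / 2 +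
              p s (R (toLp 2 ![y 0, y 1, a]))) * ⟪u s (R (toLp 2 ![y 0, y 1, a])), R (EuclideanSpace.single 2 1)⟫) -
            ∫ y : EuclideanSpace ℝ (Fin 2), (‖u s (R (toLp 2 ![y 0, y 1, b]))‖ ^ 2 / 2 +
              p s (R (toLp 2 ![y 0, y 1, b]))) * ⟪u s (R (toLp 2 ![y 0, y 1, b])), R (EuclideanSpace.single 2 1)⟫‖ₑ) ≤
        ENNReal.ofReal E₁ := by
    intro t ht R
    -- enlarge the domain to `(0,t)` after replacing the oscillation by `A` on `(0, min t T₁)`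
    calc _ ≤ ∫⁻ s in Ioo 0 (min t T₁), ENNReal.ofReal ((Real.sqrt (π * ν * (t - s)))⁻¹) * ENNReal.ofReal A := by
          refine setLIntegral_mono' measurableSet_Ioo fun s hs => ?_
          gcongr
          exact hosc s ⟨hs.1.le, (hs.2.trans_le (min_le_right _ _)).le⟩ R
      _ ≤ ∫⁻ s in Ioo 0 t, ENNReal.ofReal ((Real.sqrt (π * ν * (t - s)))⁻¹) * ENNReal.ofReal A :=
          lintegral_mono_set (Ioo_subset_Ioo_right (min_le_left _ _))
      _ ≤ ENNReal.ofReal E₁ :=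
          fluxBudget_le_of_bounded (O := fun _ => ENNReal.ofReal A) hν hA0 (fun _ _ => le_rfl) ht
  -- the full budget `≤ E₁ + max B 0`
  refine planarCeiling_of_budget hν hT hcl hLH hdec (B := E₁ + max B 0) (by positivity) fun t ht R => ?_
  rw [ENNReal.ofReal_add hE₁0 (le_max_right _ _)]
  rcases le_or_gt t T₁ with htT₁ | htT₁
  · -- `t ≤ T₁`: only the early part
    have h := hearly t ht R
    rw [min_eq_left htT₁] at h
    exact h.trans le_self_add
  · -- `T₁ < t`: split `(0,t) = (0,T₁] ∪ (T₁,t)` hmm: use `(0,t) ⊆ (0,T₁] ∪ (T₁,t)` and `(0,T₁] ⊆ (0,T₁) ∪ {T₁}`-free bound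
    have hsplit : Ioo 0 t ⊆ Ioc 0 T₁ ∪ Ioo T₁ t := Ioo_subset_Ioc_union_Ioo
    refine (lintegral_mono_set hsplit).trans ((lintegral_union_le _ _ _).trans (add_le_add ?_
      ((hlate t ⟨htT₁.le, ht.2⟩ R).trans (ENNReal.ofReal_le_ofReal (le_max_left _ _)))))
    -- the part over `(0,T₁]`: `(0,T₁] ⊆ (0,T₁) ∪ {T₁}` and the singleton is null
    have hnull : (volume : Measure ℝ) {T₁} = 0 := Real.volume_singleton
    calc _ ≤ ∫⁻ s in Ioo 0 T₁ ∪ {T₁}, _ := lintegral_mono_set (fun s hs => by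
            rcases eq_or_lt_of_le hs.2 with h | h
            · exact Or.inr h
            · exact Or.inl ⟨hs.1, h⟩)
      _ ≤ (∫⁻ s in Ioo 0 T₁, _) + ∫⁻ s in ({T₁} : Set ℝ), _ := lintegral_union_le _ _ _
      _ = ∫⁻ s in Ioo 0 T₁, _ := by rw [setLIntegral_measure_zero _ _ hnull, add_zero]
      _ ≤ ENNReal.ofReal E₁ := by
          have h := hearly t ht R
          rwa [min_eq_right htT₁.le] at h

/-- **`PlanarEnergyAPriori ⇐ LATE flux-convergence budget`, registered expanded form** (sub-goal
`planarEnergyAPriori_of_lateBudget_expanded` of stmt-NavierStokesRegularity-16855): if along every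
classical Leray–Hopf solution from a rapidly decaying datum on `[0,T)` the parabolic budget over a
final stretch `(T₁,t)`, `t ∈ [T₁,T)`, is bounded, then the body of
`PlaneEnergyCeiling.PlanarEnergyAPriori` holds (verbatim). [folklore] -/
theorem planarEnergyAPriori_of_lateBudget_expanded : (∀ (ν T : ℝ), 0 < ν → 0 < T → ∀ (u : ℝ → EuclideanSpace ℝ (Fin 3) → EuclideanSpace ℝ (Fin 3)) (p : ℝ → EuclideanSpace ℝ (Fin 3) → ℝ), Literature.Analysis.FluidPDE.IsClassicalNSSolutionOn (Set.Ico 0 T) ν 0 u p → Literature.Analysis.FluidPDE.IsLerayHopfOn T ν 0 (u 0) u → Literature.Analysis.FluidPDE.HasRapidSpatialDecay (u 0) → ∃ T₁ ∈ Set.Ico 0 T, ∃ B : ℝ, ∀ t ∈ Set.Ico T₁ T, ∀ (R : EuclideanSpace ℝ (Fin 3) ≃ₗᵢ[ℝ] EuclideanSpace ℝ (Fin 3)), (∫⁻ s in Set.Ioo T₁ t, ENNReal.ofReal ((Real.sqrt (Real.pi * ν * (t - s)))⁻¹) * (⨆ (a : ℝ) (b : ℝ), ‖(∫ y : EuclideanSpace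 ℝ (Fin 2), (‖u s (R (WithLp.toLp 2 ![y 0, y 1, a]))‖ ^ 2 / 2 + p s (R (WithLp.toLp 2 ![y 0, y 1, a]))) * inner ℝ (u s (R (WithLp.toLp 2 ![y 0, y 1, a]))) (R (EuclideanSpace.single 2 1))) - (∫ y : EuclideanSpace ℝ (Fin 2), (‖u s (R (WithLp.toLp 2 ![y 0, y 1, b]))‖ ^ 2 / 2 + p s (R (WithLp.toLp 2 ![y 0, y 1, b]))) * inner ℝ (u s (R (WithLp.toLp 2 ![y 0, y 1, b]))) (R (EuclideanSpace.single 2 1)))‖ₑ)) ≤ ENNReal.ofReal B) → ∀ (ν T : ℝ), 0 < ν → 0 < T → ∀ (u : ℝ → EuclideanSpace ℝ (Fin 3) → EuclideanSpace ℝ (Fin 3)) (p : ℝ → EuclideanSpace ℝ (Fin 3) → ℝ), Literature.Analysis.FluidPDE.IsClassicalNSSolutionOn (Set.Ico 0 T) ν 0 u p → Literature.Analysis.FluidPDE.IsLerayHopfOn T ν 0 (u 0) u → Literature.Analysis.FluidPDE.HasRapidSpatialDecay (u 0) → ∃ M : ℝ, ∀ t ∈ Set.Ico 0 T, ∀ (R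 : EuclideanSpace ℝ (Fin 3) ≃ₗᵢ[ℝ] EuclideanSpace ℝ (Fin 3)) (c : ℝ), ∫⁻ y : EuclideanSpace ℝ (Fin 2), ‖u t (R (WithLp.toLp 2 ![y 0, y 1, c]))‖ₑ ^ 2 ≤ ENNReal.ofReal M := by
  intro hlate ν T hν hT u p hcl hLH hdec
  obtain ⟨T₁, hT₁, B, hB⟩ := hlate ν T hν hT u p hcl hLH hdec
  exact planarCeiling_of_lateBudget hν hT hcl hLH hdec hT₁ hB

/-- **`PlanarEnergyAPriori ⇐ LATE flux-convergence budget`, the route declaration BY NAME.**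
[folklore] -/
theorem planarEnergyAPriori_of_lateBudget (hlate : ∀ (ν T : ℝ), 0 < ν → 0 < T → ∀ (u : ℝ → EuclideanSpace ℝ (Fin 3) → EuclideanSpace ℝ (Fin 3)) (p : ℝ → EuclideanSpace ℝ (Fin 3) → ℝ), Literature.Analysis.FluidPDE.IsClassicalNSSolutionOn (Set.Ico 0 T) ν 0 u p → Literature.Analysis.FluidPDE.IsLerayHopfOn T ν 0 (u 0) u → Literature.Analysis.FluidPDE.HasRapidSpatialDecay (u 0) → ∃ T₁ ∈ Set.Ico 0 T, ∃ B : ℝ, ∀ t ∈ Set.Ico T₁ T, ∀ (R : EuclideanSpace ℝ (Fin 3) ≃ₗᵢ[ℝ] EuclideanSpace ℝ (Fin 3)), (∫⁻ s in Set.Ioo T₁ t, ENNReal.ofReal ((Real.sqrt (Real.pi * ν * (t - s)))⁻¹) * (⨆ (a : ℝ) (b : ℝ), ‖(∫ y : EuclideanSpace ℝ (Fin 2), (‖u s (R (WithLp.toLp 2 ![y 0, y 1, a]))‖ ^ 2 / 2 + p s (R (WithLp.toLp 2 ![y 0, y 1, a]))) * inner ℝ (u s (R (WithLp.toLp 2 ![y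 0, y 1, a]))) (R (EuclideanSpace.single 2 1))) - (∫ y : EuclideanSpace ℝ (Fin 2), (‖u s (R (WithLp.toLp 2 ![y 0, y 1, b]))‖ ^ 2 / 2 + p s (R (WithLp.toLp 2 ![y 0, y 1, b]))) * inner ℝ (u s (R (WithLp.toLp 2 ![y 0, y 1, b]))) (R (EuclideanSpace.single 2 1)))‖ₑ)) ≤ ENNReal.ofReal B) :
    Summit.NavierStokesRegularity.NavierStokesRegularity.Theses.PlaneEnergyCeiling.PlanarEnergyAPriori :=
  planarEnergyAPriori_of_lateBudget_expanded hlate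

/-! ### The budget is finite before `T` (appended 2026-08-17) -/

/-- **The flux-convergence budget is FINITE for every `t < T`** along every classical Leray–Hopf
solution from a rapidly decaying datum on `[0,T)`: with the persisted decay on a closed slab
`[0,t']`, `t < t' < T`, the flux oscillation is bounded there (`enorm_bernoulliFlux_sub_le_of_decay`)
and a bounded oscillation costs `≤ 2(√(πν))⁻¹ A √t'` (`fluxBudget_le_of_bounded`). So the
content of `stub_fluxConvergenceBudget` is exactly the UNIFORMITY of the budget as `t ↑ T`.
[folklore] -/
theorem fluxBudget_lt_top (hν : 0 < ν) (hT : 0 < T) (hcl : IsClassicalNSSolutionOn (Ico 0 T) ν 0 u p)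
    (hLH : IsLerayHopfOn T ν 0 (u 0) u) (hdec : HasRapidSpatialDecay (u 0)) {t : ℝ} (ht : t ∈ Ico 0 T)
    (R : EuclideanSpace ℝ (Fin 3) ≃ₗᵢ[ℝ] EuclideanSpace ℝ (Fin 3)) :
    ∫⁻ s in Ioo 0 t, ENNReal.ofReal ((Real.sqrt (π * ν * (t - s)))⁻¹) *
        (⨆ (a : ℝ) (b : ℝ), ‖(∫ y : EuclideanSpace ℝ (Fin 2), (‖u s (R (toLp 2 ![y 0, y 1, a]))‖ ^ 2 / 2 +
              p s (R (toLp 2 ![y 0, y 1, a]))) * ⟪u s (R (toLp 2 ![y 0, y 1, a])), R (EuclideanSpace.single 2 1)⟫) -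
            ∫ y : EuclideanSpace ℝ (Fin 2), (‖u s (R (toLp 2 ![y 0, y 1, b]))‖ ^ 2 / 2 +
              p s (R (toLp 2 ![y 0, y 1, b]))) * ⟪u s (R (toLp 2 ![y 0, y 1, b])), R (EuclideanSpace.single 2 1)⟫‖ₑ) < ⊤ := by
  -- a closed slab `[0,t']` with `t < t' < T` and the persisted decay on it
  set t' : ℝ := (t + T) / 2 with ht'def
  have htt' : t < t' := by rw [ht'def]; linarith [ht.2]
  have ht'T : t' < T := by rw [ht'def]; linarith [ht.2]
  have ht' : t' ∈ Ico 0 T := ⟨ht.1.trans htt'.le, ht'T⟩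
  obtain ⟨C₀, π₀, hd⟩ := stub_decayPersistence ν T hν hT u p hcl hLH hdec t' ht'
  set A : ℝ := 2 * ((C₀ ^ 3 / 2 + C₀ ^ 2) * ∫ y : EuclideanSpace ℝ (Fin 2), (1 + ‖y‖) ^ (-(5 : ℝ))) with hA
  have hC₀ : 0 ≤ C₀ := by
    have h := (hd 0 ⟨le_rfl, ht'.1⟩ 0).1
    have : 0 ≤ (1 + ‖(0 : EuclideanSpace ℝ (Fin 3))‖) ^ 3 * ‖u 0 0‖ := by positivity
    linarith
  have hI5 : 0 ≤ ∫ y : EuclideanSpace ℝ (Fin 2), (1 + ‖y‖) ^ (-(5 : ℝ)) :=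
    integral_nonneg fun y => (Real.rpow_pos_of_pos (by positivity) _).le
  have hA0 : 0 ≤ A := by rw [hA]; positivity
  have hosc : ∀ s ∈ Ioo 0 t',
      (⨆ (a : ℝ) (b : ℝ), ‖(∫ y : EuclideanSpace ℝ (Fin 2), (‖u s (R (toLp 2 ![y 0, y 1, a]))‖ ^ 2 / 2 +
            p s (R (toLp 2 ![y 0, y 1, a]))) * ⟪u s (R (toLp 2 ![y 0, y 1, a])), R (EuclideanSpace.single 2 1)⟫) -
          ∫ y : EuclideanSpace ℝ (Fin 2), (‖u s (R (toLp 2 ![y 0, y 1, b]))‖ ^ 2 / 2 +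
            p s (R (toLp 2 ![y 0, y 1, b]))) * ⟪u s (R (toLp 2 ![y 0, y 1, b])), R (EuclideanSpace.single 2 1)⟫‖ₑ) ≤
        ENNReal.ofReal A := by
    intro s hs
    have hs' : s ∈ Icc 0 t' := ⟨hs.1.le, hs.2.le⟩
    have hsT : s ∈ Ico 0 T := ⟨hs.1.le, hs.2.trans ht'T⟩
    have hu1 : ContDiff ℝ 1 (u s) := (hcl.contDiff_velocity hsT).of_le (by exact_mod_cast le_top)
    refine iSup₂_le fun a b => ?_
    exact enorm_bernoulliFlux_sub_le_of_decay hu1 (hcl.contDiff_pressure hsT).continuous (hcl.divFree s hsT)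
      (fun x => le_mul_rpow_neg_three_of_mul_le (hd s hs' x).1)
      (fun x => le_mul_rpow_neg_three_of_mul_le (hd s hs' x).2.1) (π₀ s)
      (fun x => le_mul_rpow_neg_two_of_mul_le (hd s hs' x).2.2.2.1) R a b
  exact (fluxBudget_le_of_bounded hν hA0 hosc ⟨ht.1, htt'⟩).trans_lt ENNReal.ofReal_lt_top

/-- **The budget is finite before `T`, registered closed form** (sub-goal `fluxBudget_lt_top_closedForm`
of stmt-NavierStokesRegularity-16855): along every solution of the crux's class and every
`t < T`, `R`, the parabolic flux-convergence budget over `(0,t)` is `< ∞`. [folklore] -/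
theorem fluxBudget_lt_top_closedForm : ∀ (ν T : ℝ), 0 < ν → 0 < T → ∀ (u : ℝ → EuclideanSpace ℝ (Fin 3) → EuclideanSpace ℝ (Fin 3)) (p : ℝ → EuclideanSpace ℝ (Fin 3) → ℝ), Literature.Analysis.FluidPDE.IsClassicalNSSolutionOn (Set.Ico 0 T) ν 0 u p → Literature.Analysis.FluidPDE.IsLerayHopfOn T ν 0 (u 0) u → Literature.Analysis.FluidPDE.HasRapidSpatialDecay (u 0) → ∀ t ∈ Set.Ico 0 T, ∀ (R : EuclideanSpace ℝ (Fin 3) ≃ₗᵢ[ℝ] EuclideanSpace ℝ (Fin 3)), (∫⁻ s in Set.Ioo 0 t, ENNReal.ofReal ((Real.sqrt (Real.pi * ν * (t - s)))⁻¹) * (⨆ (a : ℝ) (b : ℝ), ‖(∫ y : EuclideanSpace ℝ (Fin 2), (‖u s (R (WithLp.toLp 2 ![y 0, y 1, a]))‖ ^ 2 / 2 + p s (R (WithLp.toLp 2 ![y 0, y 1, a]))) * inner ℝ (u s (R (WithLp.toLp 2 ![y 0, y 1, a]))) (R (EuclideanSpace.single 2 1))) - (∫ y : EuclideanSpace ℝ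 (Fin 2), (‖u s (R (WithLp.toLp 2 ![y 0, y 1, b]))‖ ^ 2 / 2 + p s (R (WithLp.toLp 2 ![y 0, y 1, b]))) * inner ℝ (u s (R (WithLp.toLp 2 ![y 0, y 1, b]))) (R (EuclideanSpace.single 2 1)))‖ₑ)) < ⊤ :=
  fun _ _ hν hT _ _ hcl hLH hdec _ ht R => fluxBudget_lt_top hν hT hcl hLH hdec ht R

end Summit.NavierStokesRegularity.NavierStokesRegularity.Theorems.PlanarEnergyAPriori

end
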